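import Literature.Geometry.Riemannian.RicciFlow
import Literature.Geometry.Riemannian.CurvatureDecomposition
import Mathlib.LinearAlgebra.Matrix.Adjugate
import Mathlib.Topology.Instances.Matrix
import Mathlib.Analysis.Calculus.Deriv.Basic
import Mathlib.Analysis.Convex.Basic
import HarnessLib

/-!
# Hamilton's curvature ODE `M' = M² + M^#` in dimension four and the maximum principle for systems
(topic `Geometry/Riemannian`)

Bottom layer of the decomposition of the named fact
`Literature.Geometry.Riemannian.hamilton_chenZhu_pinching` (`PinchingEstimates.lean`; Chen–Zhu 2006,
Lemma 2.1 = Hamilton 1997, Thms. B1.1 + B2.3). Hamilton 1997, §2.1, p. 7: "We follow the same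
procedure as in [3] (= Hamilton 1986) to reduce the proof to the preservation of inequalities
defining convex sets when we evolve the curvature matrix by a system of ordinary differential
inequalities." The reduction has two published ingredients, recorded here:

* (real definitions) **Hamilton's ODE** on block triples `(A, B, C)` of `3 × 3` real matrices
  (Hamilton 1986, §6, p. 166, the reaction term of `∂M/∂t = ΔM + M² + M^#` in the block
  decomposition `M = (A B; ᵗB C)` of the curvature operator of a 4-manifold, `Λ² = Λ²₊ ⊕ Λ²₋`):
  `A' = A² + B ᵗB + 2A^#`, `B' = AB + BC + 2B^#`, `C' = C² + ᵗB B + 2C^#`, where `M^#` is "the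
  adjoint matrix `M^# = det M · ᵗM⁻¹`" (1986, p. 157, with the explicit cofactor formula), i.e.
  the transpose of Mathlib's `Matrix.adjugate` (`Matrix.sharp`); solutions (`HamiltonODE.IsSolutionOn`,
  derivatives taken entrywise, so that no norm on matrices is needed) and **forward invariance of a
  time-dependent family of sets relative to a constraint family** (`HamiltonODE.IsInvariantRel`;
  Hamilton 1986, Lemma 4.1 / Thm. 4.3: "solutions of the ODE which start in `X` remain in `X`";
  Chow–Lu 2004, Thm. 3 for sets `𝒦(t)` depending on `t`; Hamilton 1997, Thms. B1.3–B2.3 are all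
  of the form "if the previous estimates hold, the inequality … is preserved").
* NAMED FACT `hamilton_maximumPrinciple_curvatureODE` — **Hamilton's maximum principle for
  systems applied to the curvature of the Ricci flow on a closed 4-manifold** (Hamilton 1986,
  Thm. 4.3, p. 162, with §2 (Uhlenbeck's trick, `∂M/∂t = ΔM + M² + M^#`, p. 157) and §6 (the
  block system, p. 166), as invoked in the proof of the convergence criterion 5.2, p. 164; the
  time-dependent version is Chow–Lu 2004, Thm. 3, "special cases of this result have been proved
  by Hamilton … section 2.2 and section 2.3 in [H5]" (= Hamilton 1997)): if `Z(t)` is a family of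
  closed convex sets of block triples with closed space-time track, forward invariant under
  Hamilton's ODE, and the blocks `(A, B, C)` of `g(0)` lie in `Z(0)` at every point in every
  orthonormal frame, then the blocks of `g(t)` lie in `Z(t)` for all `t ∈ [0, T)`, along every
  Ricci flow of Riemannian metrics on `[0, T)` on a closed smooth 4-manifold (frame-wise over
  `blockA/B/C` of `CurvatureDecomposition.lean`, exactly as in `hamilton_chenZhu_pinching`).

## Design notes

* Quantifying over *all* orthonormal frames makes the fibrewise set
  `{Rm_x : blocks in every frame lie in Z(t)}` automatically `O(4)`-invariant, hence invariant
  under parallel translation (conditions I/III of Chow–Lu), and convex and closed when `Z(t)` is;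
  this is Hamilton's `X = P ×_G Z` (1986, end of §4, p. 163).
* **Sign of the `B^#` term.** Hamilton 1986 derives `B' = AB + BC + 2B^#` for bases of `Λ²₊`,
  `Λ²₋` oriented alike as copies of `so(3)`. For the printed bases of Hamilton 1997, p. 5 (used by
  `blockA/B/C`: `φ = (12+34, 13+42, 14+23)`, `ψ = (12−34, 13−42, 14−23)`) one checks
  `[φ₁, φ₂] = -2φ₃` but `[ψ₁, ψ₂] = +2ψ₃`, so in the tree's convention the `B`-equation carries
  `-2B^#` (equivalently: it is Hamilton's equation for `-B`; on `S³ × ℝ` the tree's `B` is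
  `K·diag(1,1,-1)`). Reflecting `B ↦ -B` conjugates the two systems (`HamiltonODE.reflectB_field_reflectB`,
  `HamiltonODE.IsInvariantRel.reflect`), and every pinching set of Hamilton 1997 / Chen–Zhu 2006
  depends on `B` only through its singular values, i.e. is reflection-symmetric; the named fact is
  therefore stated for Hamilton's printed system **together with** the hypothesis that each
  `Z(t)` is symmetric under `B ↦ -B`, which makes the choice of sign immaterial.
* Invariance is required on every subinterval `[t₀, t₁] ⊆ [0, ∞)` and for every (local) `C¹`
  solution; this is the property Hamilton's differential-inequality arguments establish, and it is
  stronger than the hypothesis of Chow–Lu's Thm. 3 (solutions on `[t₀, T]`), so the fact as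
  stated is weaker than the printed theorem. The field is polynomial, hence locally Lipschitz;
  Hamilton (1986, p. 160) and Chow–Lu only use it near the compact range of the solution.
* Not here: the pinching sets and the chain of invariance theorems of Hamilton 1997, §B
  (`PinchingEstimatesODE*.lean`), and any PDE: the Laplacian of bundle sections, Uhlenbeck's trick
  and the evolution equation of the curvature are not in Mathlib or the tree, which is why the
  maximum principle is a named fact.

## References

* R. S. Hamilton, *Four-manifolds with positive curvature operator*, J. Differential Geom. 24
  (1986) 153–179: §2 (p. 157, `∂M/∂t = ΔM + M² + M^#`; p. 157 the adjoint matrix `M^#`), §3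
  (Lipschitz calculus), §4 (Lemma 4.1, Thm. 4.2, Thm. 4.3, pp. 160–163), §5 (Def. 5.1, 5.2,
  pp. 163–164), §6 (p. 166, the block system). [Hamilton1986]
* B. Chow, P. Lu, *The time-dependent maximum principle for systems of parabolic equations
  subject to an avoidance set*, Pacific J. Math. 214 (2004) 201–222 (arXiv:math/0211209), §2,
  Thm. 2 (= Hamilton's Thm. 4.3) and Thm. 3 (time-dependent sets). [ChowLu2004]
* R. S. Hamilton, *Four-manifolds with positive isotropic curvature*, Comm. Anal. Geom. 5 (1997)
  1–92, §2.1, p. 7 (the reduction), Thms. 1.2–2.3. [Hamilton1997]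
* B.-L. Chen, X.-P. Zhu, J. Differential Geom. 74 (2006) 177–264, §2, Lemma 2.1. [ChenZhu2006]
-/

noncomputable section

open Set
open scoped Manifold ContDiff Topology Matrix

/-! ### Hamilton's adjoint matrix `M^#` -/

namespace Matrix

/-- **Hamilton's `M^#`** for a `3 × 3` real matrix (Hamilton 1986, §2, p. 157: "the matrix `M^#`
is just the adjoint matrix `M^# = det M · ᵗM⁻¹`", with the explicit formula
`(a b c; d e f; g h k)^# = (ek−fh, fg−dk, dh−eg; ch−bk, ak−cg, bg−ah; bf−ce, cd−af, ae−bd)`, the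
matrix of cofactors): the transpose of Mathlib's `adjugate`. For symmetric `M = diag(m₁, m₂, m₃)`
it is `diag(m₂m₃, m₁m₃, m₁m₂)`. A deliberate dot-notation extension of Mathlib's `Matrix`
namespace. [cite: Hamilton1986, §2, p. 157] -/
def sharp (M : Matrix (Fin 3) (Fin 3) ℝ) : Matrix (Fin 3) (Fin 3) ℝ := (adjugate M)ᵀ

/-- `M^#` is quadratic, so `(-M)^# = M^#` for `3 × 3` matrices. [folklore] -/
theorem sharp_neg (M : Matrix (Fin 3) (Fin 3) ℝ) : (-M).sharp = M.sharp := by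
  unfold sharp
  rw [show -M = (-1 : ℝ) • M by simp, adjugate_smul]
  simp

/-- `(ᵗM)^# = ᵗ(M^#)`. [folklore] -/
theorem sharp_transpose (M : Matrix (Fin 3) (Fin 3) ℝ) : Mᵀ.sharp = M.sharpᵀ := by
  simp [sharp, adjugate_transpose]

/-- The diagonal entries of `M^#` are the complementary `2 × 2` minors, e.g.
`(M^#)₀₀ = M₁₁ M₂₂ - M₁₂ M₂₁` (Hamilton's `ek - fh`). [cite: Hamilton1986, §2, p. 157] -/
theorem sharp_apply_zero_zero (M : Matrix (Fin 3) (Fin 3) ℝ) :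
    M.sharp 0 0 = M 1 1 * M 2 2 - M 1 2 * M 2 1 := by
  simp [sharp, adjugate_fin_three]

end Matrix

namespace Literature.Geometry.Riemannian

/-! ### Hamilton's ODE on block triples -/

namespace HamiltonODE

/-- Block triples `(A, B, C)` of `3 × 3` real matrices: the curvature operator
`M = (A B; ᵗB C)` of a 4-manifold in the decomposition `Λ² = Λ²₊ ⊕ Λ²₋` (Hamilton 1986, §6;
Hamilton 1997, p. 4; the tree's `blockA`, `blockB`, `blockC`). [cite: Hamilton1986, §6, p. 165] -/
abbrev Blocks : Type :=
  Matrix (Fin 3) (Fin 3) ℝ × Matrix (Fin 3) (Fin 3) ℝ × Matrix (Fin 3) (Fin 3) ℝ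

/-- **Hamilton's ODE** `M' = M² + M^#` in block form (Hamilton 1986, §6, p. 166, as printed):
`A' = A² + B ᵗB + 2A^#`, `B' = AB + BC + 2B^#`, `C' = C² + ᵗB B + 2C^#`. (For the sign of the
`B^#` term in the tree's frame convention see the module docstring: the named fact below is made
insensitive to it.) [cite: Hamilton1986, §6, p. 166] -/
def field (p : Blocks) : Blocks :=
  (p.1 * p.1 + p.2.1 * p.2.1ᵀ + (2 : ℝ) • p.1.sharp,
    p.1 * p.2.1 + p.2.1 * p.2.2 + (2 : ℝ) • p.2.1.sharp,
    p.2.2 * p.2.2 + p.2.1ᵀ * p.2.1 + (2 : ℝ) • p.2.2.sharp)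

/-- The reflection `(A, B, C) ↦ (A, -B, C)` of block triples (it preserves the singular values
of `B`, hence every pinching set of Hamilton 1997 / Chen–Zhu 2006). [folklore] -/
def reflectB (p : Blocks) : Blocks := (p.1, -p.2.1, p.2.2)

/-- The reflection is an involution. [folklore] -/
@[simp] theorem reflectB_reflectB (p : Blocks) : reflectB (reflectB p) = p := by
  simp [reflectB]

/-- Conjugating Hamilton's field by the reflection `B ↦ -B` flips exactly the sign of the `B^#`
term: `A' = A² + BᵗB + 2A^#`, `B' = AB + BC - 2B^#`, `C' = C² + ᵗBB + 2C^#` (the form of the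
system in the frame convention of Hamilton 1997, p. 5 / `blockB`). [folklore] -/
theorem reflectB_field_reflectB (p : Blocks) :
    reflectB (field (reflectB p)) =
      (p.1 * p.1 + p.2.1 * p.2.1ᵀ + (2 : ℝ) • p.1.sharp,
        p.1 * p.2.1 + p.2.1 * p.2.2 - (2 : ℝ) • p.2.1.sharp,
        p.2.2 * p.2.2 + p.2.1ᵀ * p.2.1 + (2 : ℝ) • p.2.2.sharp) := by
  obtain ⟨A, B, C⟩ := p
  simp only [reflectB, field, Matrix.sharp_neg, Matrix.transpose_neg, Matrix.neg_mul,
    Matrix.mul_neg, neg_neg, neg_add_rev, Prod.mk.injEq, true_and, and_true]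
  abel

/-- **Derivative of a curve of block triples**, taken entrywise: `γ` has derivative `γ'` at `t`
iff each of the `27` real entry functions has the corresponding entry of `γ'` as derivative
(equivalent to the Fréchet derivative in the finite-dimensional space of triples; phrased
entrywise so that no norm on matrices has to be fixed). [folklore] -/
def HasDerivAt (γ : ℝ → Blocks) (γ' : Blocks) (t : ℝ) : Prop :=
  (∀ i j, _root_.HasDerivAt (fun s ↦ (γ s).1 i j) (γ'.1 i j) t) ∧
    (∀ i j, _root_.HasDerivAt (fun s ↦ (γ s).2.1 i j) (γ'.2.1 i j) t) ∧
    ∀ i j, _root_.HasDerivAt (fun s ↦ (γ s).2.2 i j) (γ'.2.2 i j) t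

/-- Reflecting a differentiable curve reflects its derivative. [folklore] -/
theorem HasDerivAt.reflectB {γ : ℝ → Blocks} {γ' : Blocks} {t : ℝ} (h : HasDerivAt γ γ' t) :
    HasDerivAt (fun s ↦ reflectB (γ s)) (reflectB γ') t :=
  by
  refine ⟨h.1, fun i j ↦ ?_, h.2.2⟩
  have h' := (h.2.1 i j).neg
  simp only [HamiltonODE.reflectB, Matrix.neg_apply]
  exact h'

/-- `γ` solves the ODE `γ' = F(γ)` on the time set `S`: at every `s ∈ S` it has (two-sided)
derivative `F (γ s)`. [cite: Hamilton1986, §4, p. 160 (ODE)] -/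
def IsSolutionOn (F : Blocks → Blocks) (γ : ℝ → Blocks) (S : Set ℝ) : Prop :=
  ∀ s ∈ S, HasDerivAt γ (F (γ s)) s

/-- A solution on `S` is a solution on every `S' ⊆ S`. [folklore] -/
theorem IsSolutionOn.mono {F : Blocks → Blocks} {γ : ℝ → Blocks} {S S' : Set ℝ}
    (h : IsSolutionOn F γ S) (hS : S' ⊆ S) : IsSolutionOn F γ S' :=
  fun s hs ↦ h s (hS hs)

/-- A solution of `γ' = F(γ)` reflects to a solution of the conjugated system
`δ' = (reflectB ∘ F ∘ reflectB)(δ)`. [folklore] -/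
theorem IsSolutionOn.reflectB {F : Blocks → Blocks} {γ : ℝ → Blocks} {S : Set ℝ}
    (h : IsSolutionOn F γ S) :
    IsSolutionOn (fun p ↦ HamiltonODE.reflectB (F (HamiltonODE.reflectB p)))
      (fun s ↦ HamiltonODE.reflectB (γ s)) S := by
  intro s hs
  simpa using (h s hs).reflectB

/-- **Forward invariance relative to a constraint family** (Hamilton 1986, Lemma 4.1 and
Thm. 4.3: "the solutions of the ODE which start in `X` remain in `X`"; Chow–Lu 2004, Thm. 3 for
time-dependent `𝒦(t)`; Hamilton 1997, Thms. 1.3–2.3: "if the previous estimates hold, the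
inequality … is preserved"). The family `Z : ℝ → Set Blocks` is *forward invariant under
`γ' = F(γ)` relative to `K`* if for all `0 ≤ t₀ ≤ t₁` and every solution `γ` on `[t₀, t₁]`
staying in the constraint sets (`γ s ∈ K s` for `s ∈ [t₀, t₁]`), `γ t₀ ∈ Z t₀` implies
`γ t₁ ∈ Z t₁`. [cite: Hamilton1986, §4, Lemma 4.1 and Thm. 4.3 (pp. 160–162)]
[cite: ChowLu2004, §2, Thm. 3] -/
def IsInvariantRel (F : Blocks → Blocks) (K Z : ℝ → Set Blocks) : Prop :=
  ∀ (γ : ℝ → Blocks) (t₀ t₁ : ℝ), 0 ≤ t₀ → t₀ ≤ t₁ → IsSolutionOn F γ (Icc t₀ t₁) →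
    (∀ s ∈ Icc t₀ t₁, γ s ∈ K s) → γ t₀ ∈ Z t₀ → γ t₁ ∈ Z t₁

/-- **Forward invariance** of a time-dependent family of sets under `γ' = F(γ)` (no constraint).
[cite: Hamilton1986, §4, Thm. 4.3 (p. 162)] [cite: ChowLu2004, §2, Thm. 3] -/
def IsInvariant (F : Blocks → Blocks) (Z : ℝ → Set Blocks) : Prop :=
  IsInvariantRel F (fun _ ↦ univ) Z

variable {F : Blocks → Blocks} {K K' Z Z' : ℝ → Set Blocks}

/-- Unfolding `IsInvariant`: the vacuous constraint disappears. [folklore] -/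
theorem isInvariant_iff : IsInvariant F Z ↔
    ∀ (γ : ℝ → Blocks) (t₀ t₁ : ℝ), 0 ≤ t₀ → t₀ ≤ t₁ → IsSolutionOn F γ (Icc t₀ t₁) →
      γ t₀ ∈ Z t₀ → γ t₁ ∈ Z t₁ :=
  ⟨fun h γ t₀ t₁ h₀ h₁ hγ ↦ h γ t₀ t₁ h₀ h₁ hγ fun _ _ ↦ mem_univ _,
    fun h γ t₀ t₁ h₀ h₁ hγ _ ↦ h γ t₀ t₁ h₀ h₁ hγ⟩

/-- An invariant family contains the whole future of a solution starting in it. [folklore] -/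
theorem IsInvariant.mem_of_mem {γ : ℝ → Blocks} {t₀ t₁ : ℝ} (h : IsInvariant F Z) (h₀ : 0 ≤ t₀)
    (hγ : IsSolutionOn F γ (Icc t₀ t₁)) (hin : γ t₀ ∈ Z t₀) {s : ℝ} (hs : s ∈ Icc t₀ t₁) :
    γ s ∈ Z s :=
  isInvariant_iff.1 h γ t₀ s h₀ hs.1 (hγ.mono (Icc_subset_Icc_right hs.2)) hin

/-- Weakening the constraint family. [folklore] -/
theorem IsInvariantRel.mono_left (h : IsInvariantRel F K Z) (hK : ∀ t, 0 ≤ t → K' t ⊆ K t) :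
    IsInvariantRel F K' Z :=
  fun γ t₀ t₁ h₀ h₁ hγ hK' hin ↦
    h γ t₀ t₁ h₀ h₁ hγ (fun s hs ↦ hK s (h₀.trans hs.1) (hK' s hs)) hin

/-- Two families invariant relative to the same constraint have invariant intersection. [folklore] -/
theorem IsInvariantRel.inter (h : IsInvariantRel F K Z) (h' : IsInvariantRel F K Z') :
    IsInvariantRel F K (fun t ↦ Z t ∩ Z' t) :=
  fun γ t₀ t₁ h₀ h₁ hγ hK hin ↦ ⟨h γ t₀ t₁ h₀ h₁ hγ hK hin.1, h' γ t₀ t₁ h₀ h₁ hγ hK hin.2⟩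

/-- **Chaining** (the logical form of Hamilton 1997, Thms. 1.3–2.3): if `Z` is invariant and
contained in the constraint family `K`, and `Z'` is invariant relative to `K`, then `Z ∩ Z'` is
invariant. [folklore] -/
theorem IsInvariant.inter_rel (h : IsInvariant F Z) (hZK : ∀ t, 0 ≤ t → Z t ⊆ K t)
    (h' : IsInvariantRel F K Z') : IsInvariant F (fun t ↦ Z t ∩ Z' t) := by
  refine isInvariant_iff.2 fun γ t₀ t₁ h₀ h₁ hγ hin ↦ ⟨h.mem_of_mem h₀ hγ hin.1 ⟨h₁, le_rfl⟩, ?_⟩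
  exact h' γ t₀ t₁ h₀ h₁ hγ
    (fun s hs ↦ hZK s (h₀.trans hs.1) (h.mem_of_mem h₀ hγ hin.1 hs)) hin.2

/-- A constant-in-time invariant family stays invariant when intersected with a family that is
invariant relative to it. [folklore] -/
theorem IsInvariant.inter_rel_self (h : IsInvariant F Z) (h' : IsInvariantRel F Z Z') :
    IsInvariant F (fun t ↦ Z t ∩ Z' t) :=
  h.inter_rel (fun _ _ ↦ Subset.rfl) h'

/-- **The sign of the `B^#` term is immaterial for reflection-symmetric families**: if `K` and `Z`
are symmetric under `B ↦ -B`, invariance relative to `K` under `γ' = F(γ)` implies invariance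
under the conjugated system `δ' = (reflectB ∘ F ∘ reflectB)(δ)` (and conversely, by involutivity).
[folklore] -/
theorem IsInvariantRel.reflect (h : IsInvariantRel F K Z)
    (hK : ∀ t p, p ∈ K t → HamiltonODE.reflectB p ∈ K t)
    (hZ : ∀ t p, p ∈ Z t → HamiltonODE.reflectB p ∈ Z t) :
    IsInvariantRel (fun p ↦ HamiltonODE.reflectB (F (HamiltonODE.reflectB p))) K Z := by
  intro γ t₀ t₁ h₀ h₁ hγ hKγ hin
  have hsol : IsSolutionOn F (fun s ↦ HamiltonODE.reflectB (γ s)) (Icc t₀ t₁) := by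
    simpa using hγ.reflectB
  simpa using hZ t₁ _ (h _ t₀ t₁ h₀ h₁ hsol (fun s hs ↦ hK s _ (hKγ s hs)) (hZ t₀ _ hin))

end HamiltonODE

/-! ### Named fact: the maximum principle for the curvature ODE -/

open Lorentzian HamiltonODE

universe u

/-- NAMED FACT (**Hamilton's maximum principle for systems, for the curvature of the Ricci flow on
a closed 4-manifold**; Hamilton 1986, §4, Thm. 4.3, p. 162: "If the solutions of the ODE's in each
fiber remain in `X`, then the solutions of the PDE remain in `X`", for `X ⊆ V` closed, invariant
under parallel translation and fibrewise convex, applied as on pp. 163–164 (§5, 5.2) to the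
curvature operator `M`, which after Uhlenbeck's trick satisfies `∂M/∂t = ΔM + M² + M^#` (§2,
p. 157) with the block form of §6, p. 166; time-dependent sets `𝒦(t)` with closed space-time
track: Chow–Lu 2004, Thm. 3 ("special cases … proved by Hamilton … section 2.2 and section 2.3 in
[H5]"); this is the reduction used throughout Hamilton 1997, §2 (p. 7) and hence behind Chen–Zhu
2006, Lemma 2.1). Frame-wise form over the tree's blocks: let `(g, cov)` be a Ricci flow of
Riemannian metrics on `[0, T)` (`IsRicciFlow`) on a closed smooth 4-manifold `M`, and
`Z : ℝ → Set Blocks` a family of closed convex sets, symmetric under `B ↦ -B` (see the module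
docstring: this makes the sign convention of the `B^#` term irrelevant), with closed space-time
track over `t ≥ 0`, forward invariant under Hamilton's ODE (`HamiltonODE.IsInvariant field Z`).
If at `t = 0` the blocks `(A, B, C) = (blockA, blockB, blockC)` of `(g 0, cov 0)` lie in `Z 0` at
every point in every `g 0`-orthonormal frame, then for every `t ∈ [0, T)` the blocks of
`(g t, cov t)` lie in `Z t` at every point in every `g t`-orthonormal frame. Users take
`(h : hamilton_maximumPrinciple_curvatureODE)`.
[cite: Hamilton1986, §4, Thm. 4.3 (p. 162), with §2 (p. 157), §5 (5.2, p. 164) and §6 (p. 166)]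
[cite: ChowLu2004, §2, Thm. 3] [cite: Hamilton1997, §2.1, p. 7] -/
def hamilton_maximumPrinciple_curvatureODE : Prop :=
  ∀ (M : Type u) [TopologicalSpace M] [T2Space M] [SecondCountableTopology M] [CompactSpace M]
    [ChartedSpace (EuclideanSpace ℝ (Fin 4)) M] [IsManifold (𝓡 4) ∞ M] (T : ℝ)
    (g : ℝ → PseudoRiemannianMetric (𝓡 4) ∞ (EuclideanSpace ℝ (Fin 4))
      (TangentSpace (𝓡 4) : M → Type _))
    (cov : ℝ → CovariantDerivative (𝓡 4) (EuclideanSpace ℝ (Fin 4))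
      (TangentSpace (𝓡 4) : M → Type _)),
    IsRicciFlow g cov (Ico 0 T) → (∀ t ∈ Ico 0 T, (g t).IsRiemannian) →
    ∀ Z : ℝ → Set Blocks,
      (∀ t, IsClosed (Z t)) → (∀ t, Convex ℝ (Z t)) →
      IsClosed {q : ℝ × Blocks | 0 ≤ q.1 ∧ q.2 ∈ Z q.1} →
      (∀ t, ∀ p ∈ Z t, reflectB p ∈ Z t) → IsInvariant field Z →
      (∀ (x : M) (e : Fin 4 → TangentSpace (𝓡 4) x), (g 0).IsOrthonormalFrame x e →
        ((g 0).blockA (cov 0) x e, (g 0).blockB (cov 0) x e, (g 0).blockC (cov 0) x e) ∈ Z 0) →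
      ∀ t ∈ Ico 0 T, ∀ (x : M) (e : Fin 4 → TangentSpace (𝓡 4) x),
        (g t).IsOrthonormalFrame x e →
          ((g t).blockA (cov t) x e, (g t).blockB (cov t) x e, (g t).blockC (cov t) x e) ∈ Z t

end Literature.Geometry.Riemannian

end
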